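import Literature.AlgebraicGeometry.GroupSchemes.BarsottiTateGroupBaseChange
import Literature.AlgebraicGeometry.GroupSchemes.GroupSchemeBaseChangeSquarePoints
import Literature.AlgebraicGeometry.AbelianSchemes.AbelianSchemeOverLevelBaseChange
import Literature.AlgebraicGeometry.Morphisms.FpqcDescentOfMorphisms
import HarnessLib

/-!
# The kernel of the reduced quotient map in the Serre–Tate lifting is the `p`-torsion
# ([Katz1981SerreTate] §1.2, proof of Thm. 1.2.1; [Tate1967] §2 (2.4))

Topic `Literature/AlgebraicGeometry/AbelianSchemes`; namespace `Literature.AlgebraicGeometry.AbelianSchemes.SerreTate`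
(shared with the sibling ★ `SerreTateQuotientReductionSquare`, organs E4P ∕ E4T).
THEOREMS ONLY (no definition, no named fact, no instance, no notation, no `sorry`).  Cell `hodgecm-mathlib` (D-0151 ∕ D-0183
FLOOR 0), P6 «MOD programme», Row 4B «σ2», socket E4 «REDUCTION» of `Cruxes/HLiu418/Lines/F0_P6b_SerreTateSigma2.lean`, organ
E4K «KERNEL OF THE REDUCTION» of the desk's sub-sub-line `F0P6bSigma2ReductionOfQuotient` (desk F0P6b-plan (g13), seat P6b-A7);
generic, count-neutral capital on `--supports stmt-HodgeConjecture-24832`.  HC_CM is proved only modulo the printed citations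
until rung 0 closes; nothing here is about HC.

THE PRINT.  [Katz1981SerreTate] §1.2, proof of Thm. 1.2.1 (p. 142): in the Serre–Tate lifting one divides a lift `Y` of `X₀`
by the finite flat subgroup `Z = β(B[p²])`, the image of the lifted torsion layer, and the quotient `X = Y ⧸ Z` reduces to
`X₀ ⧸ X₀[p] ≅ X₀`; the one point to check is that REDUCING `Z` modulo the nilpotent ideal gives exactly `X₀[p]`, i.e. that the
reduction `π₀ : X₀ → X ×_A (A⧸J)` of the quotient map `π : Y → X` has kernel `X₀[p]` on points.  [Tate1967] §2 (2.4): the layers of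
`A[p^∞]` are the kernels `A[pⁿ]` and `[p] : B[p²] ↠ B[p]` is an fppf epimorphism.  THIS FILE proves that kernel statement by a
pure diagram chase from the RELATIONS of the σ2 road — no nilpotence, no Artinian hypothesis and no formal smoothness is used
(they are carried as inert binders only in the VERBATIM organ of §3):

* the SETTING (§1–§2, any base change `q : S′ → S`): `X₀ ∕ S′` an abelian scheme with kernel embeddings `i₀ n : B₀[pⁿ] → X₀`
  (homomorphisms; `i₀ 1` cartesian against `[p]`; `incl 1 ≫ i₀ 2 = i₀ 1`), `c : B₀ → B` a base change of Barsotti–Tate groups along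
  `q` (★ `BTGroup.IsBaseChangeVia`), `GY : X₀ → Y` a base change of abelian schemes (★ `AbelianSchemeOver.IsBaseChangeVia`),
  `β n : B[pⁿ] → Y` with the REDUCTION CLAUSE `c n ≫ β n = (i₀ n)^p ≫ GY`, a subobject `iZ : Z ↪ Y` receiving an fppf cover
  `b : B[p²] ↠ Z` with `b ≫ iZ = β 2`, a morphism `π : Y → X` with KERNEL CLAUSE `u ≫ π = 1 ↔ u factors through iZ`, and a
  morphism `π₀ : X₀ → X ×_S S′` REDUCING `π` (`π₀ ≫ pr₁ = GY ≫ π`);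
* §1 `comp_reduction_eq_one_iff` — `π₀ u = 1 ↔ π (GY u) = 1` (points of `X ×_S S′` are tested after `pr₁`, ★
  `GroupSchemeBaseChangeSquarePoints`);  `torsionOne_comp_reduction_eq_one` — `i₀ 1 ≫ π₀ = 1`: test after the fppf epimorphism
  `[p] : B₀[p²] ↠ B₀[p]` (★ `FpqcDescentOfMorphisms.hom_ext_of_fpqc`), where `[p] ≫ i₀ 1 = (i₀ 2)^p` reduces `β 2 = b ≫ iZ` and
  `iZ ≫ π = 1`;
* §2 `comp_pow_eq_one_of_comp_reduction_eq_one` — `π₀ u = 1 → p·u = 1`: `GY u` lies in `Z`, so on the fppf cover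
  `T′ = T ×_Z B[p²] ↠ T` it is `β 2 (w₂) = GY ((i₀ 2)^p (w₀))` with `w₂ = c 2 (w₀)` (cartesian `c 2`), whence `u|T′ = (i₀ 2)^p (w₀)`
  (lifting through the cartesian `GY` is injective) and `p·u|T′ = (i₀ 2)^{p²} (w₀) = 1` (`B₀[p²]` is killed by `p²`); descend along
  `T′ ↠ T`;  `comp_reduction_eq_one_iff_comp_pow_eq_one` — the two together: `Ker π₀ = X₀[p]` on points;
* §3 `kernelOfReduction` — the organ E4K of the σ2 sub-sub-line VERBATIM (its `Lines`-side predicate `IsTorsionTower` spelled by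
  its three clauses, so that the junction's `type_of%` binder is fed by name), by `exact`ing §2.

## References
* [Katz1981SerreTate] N. M. Katz, *Serre–Tate local moduli*, LNM 868 (1981), Exp. V-bis, §1.2, proof of Thm. 1.2.1 (p. 142).
* [Tate1967] J. Tate, *p-divisible groups*, Proc. Conf. Local Fields (Driebergen 1966), Springer (1967), §2 (2.1), (2.4).
* [Messing1972] W. Messing, *The Crystals Associated to Barsotti–Tate Groups*, LNM 264 (1972), Ch. I (1.1)–(1.6) (base change of
  the layers).
* [GortzWedhorn2020] U. Görtz, T. Wedhorn, *Algebraic Geometry I* (2nd ed., 2020), Thm. 14.72 (fpqc descent of morphisms).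
-/

noncomputable section

-- Mathlib's `Over`/pull-back API is stated across semireducible wrappers (as in the ★ `GroupSchemes/*` files).
set_option backward.isDefEq.respectTransparency false

universe u

open CategoryTheory CategoryTheory.Limits AlgebraicGeometry MonoidalCategory CartesianMonoidalCategory IsLocalRing
open scoped MonObj

namespace Literature.AlgebraicGeometry.AbelianSchemes

namespace SerreTate

open Literature.AlgebraicGeometry.GroupSchemes Literature.AlgebraicGeometry.Morphisms

section General

variable {S S' : Scheme.{u}} {q : S' ⟶ S} {p h : ℕ}

/-! ## §1 Points of the reduced quotient: test after `pr₁`; the torsion layer `i₀ 1` dies under `π₀` -/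

/-- **Points of `X ×_S S′` are tested after `pr₁`.**  `X₀ ∕ S′`, `Y, X ∕ S` abelian schemes, `GY : X₀ → Y` over `q : S′ → S`,
`π : Y → X`, and `π₀ : X₀ → X ×_S S′` a morphism REDUCING `π` (`π₀ ≫ pr₁ = GY ≫ π`).  For a `T`-point `u` of `X₀` (`T` over `S′`) and
the `S`-point `U` of `Y` with underlying map `u ≫ GY`:  `u ≫ π₀ = 1 ↔ U ≫ π = 1` (the first projection `X ×_S S′ → X` is a base
change of group schemes, ★ `AbelianSchemeOver.baseChange_isBaseChangeVia`: it is injective on `S′`-points and carries the unit to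
the unit). [cite: Katz1981SerreTate, §1.2 proof of Thm. 1.2.1 (p. 142)] -/
theorem comp_reduction_eq_one_iff (X₀ : AbelianSchemeOver S') (Y X : AbelianSchemeOver S) (GY : X₀.X.left ⟶ Y.X.left)
    (π : Y.X ⟶ X.X) (π₀ : X₀.X ⟶ (X.baseChange q).X) (hπ₀F : π₀.left ≫ pullback.fst X.X.hom q = GY ≫ π.left)
    {T : Over S'} (u : T ⟶ X₀.X) {t : T.left ⟶ S} (ht : t = T.hom ≫ q) (U : Over.mk t ⟶ Y.X)
    (hU : U.left = u.left ≫ GY) : u ≫ π₀ = 1 ↔ U ≫ π = 1 := by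
  subst ht
  obtain ⟨-, hPX, hηX, -⟩ := X.baseChange_isBaseChangeVia q
  have key : (u ≫ π₀).left ≫ pullback.fst X.X.hom q = (U ≫ π).left := by
    rw [Over.comp_left, Over.comp_left, hU, Category.assoc, hπ₀F, Category.assoc]
  have one : (1 : T ⟶ (X.baseChange q).X).left ≫ pullback.fst X.X.hom q = (1 : Over.mk (T.hom ≫ q) ⟶ X.X).left := by
    rw [Hom.one_def, Hom.one_def, Over.comp_left, Over.comp_left, Over.toUnit_left, Over.toUnit_left, Category.assoc, hηX]
    exact (Category.assoc _ _ _).symm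
  constructor
  · intro hu
    apply Over.OverMorphism.ext
    rw [← key, hu, one]
  · intro hUπ
    apply eq_of_left_comp_eq_of_isPullback hPX
    rw [key, hUπ, one]

/-- **The first torsion layer dies under the reduced quotient map: `i₀ 1 ≫ π₀ = 1`.**  Setting: kernel embeddings
`i₀ n : B₀[pⁿ] → X₀` (homomorphisms, `incl 1 ≫ i₀ 2 = i₀ 1`), `c : B₀ → B` a base change of Barsotti–Tate groups along `q`,
`β n : B[pⁿ] → Y` with the reduction clause `c n ≫ β n = (i₀ n)^p ≫ GY`, `b ≫ iZ = β 2` and `iZ ≫ π = 1` (the subgroup `Z` dies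
under `π`), `π₀` reducing `π`.  Proof: after the fppf EPIMORPHISM `[p] : B₀[p²] ↠ B₀[p]` ([Tate1967] §2: flat and surjective, hence
an epimorphism of schemes, ★ `hom_ext_of_fpqc`) the map `i₀ 1 ≫ π₀` becomes `(i₀ 2)^p ≫ π₀` (`[p] ≫ incl = p`), whose push-forward
along `pr₁` is `π ∘ GY ∘ (i₀ 2)^p = π ∘ β 2 ∘ c 2 = π ∘ iZ ∘ b ∘ c 2 = 1`. [cite: Katz1981SerreTate, §1.2 proof of Thm. 1.2.1 (p. 142)]
[cite: Tate1967, §2 (2.1) and (2.4)] -/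
theorem torsionOne_comp_reduction_eq_one (X₀ : AbelianSchemeOver S') (B₀ : BTGroup S' p h) (i₀ : ∀ n, B₀.G n ⟶ X₀.X)
    (hi₀m : ∀ n, letI := B₀.grpObj n; IsMonHom (i₀ n)) (hi₀i : ∀ n, B₀.incl n ≫ i₀ (n + 1) = i₀ n)
    (B : BTGroup S p h) (c : ∀ n, (B₀.G n).left ⟶ (B.G n).left) (hBc : B₀.IsBaseChangeVia B q c)
    (Y : AbelianSchemeOver S) (GY : X₀.X.left ⟶ Y.X.left)
    (β : ∀ n, B.G n ⟶ Y.X) (hβ : ∀ n, c n ≫ (β n).left = ((i₀ n) ^ p).left ≫ GY)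
    (Z : Over S) (iZ : Z ⟶ Y.X) (b : B.G 2 ⟶ Z) (hbZ : b ≫ iZ = β 2)
    (X : AbelianSchemeOver S) (π : Y.X ⟶ X.X) (hiZπ : iZ ≫ π = 1)
    (π₀ : X₀.X ⟶ (X.baseChange q).X) (hπ₀F : π₀.left ≫ pullback.fst X.X.hom q = GY ≫ π.left) :
    i₀ 1 ≫ π₀ = 1 := by
  letI : ∀ n, GrpObj (B₀.G n) := B₀.grpObj
  letI : ∀ n, GrpObj (B.G n) := B.grpObj
  haveI : ∀ n, IsMonHom (i₀ n) := hi₀m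
  obtain ⟨-, hPX, hηX, -⟩ := X.baseChange_isBaseChangeVia q
  obtain ⟨wc, -, -, -⟩ := hBc.1 2
  -- `[p] ≫ i₀ 1 = (i₀ 2)^p`
  have hpi : B₀.pMap 1 ≫ i₀ 1 = (i₀ 2) ^ p := by
    rw [← hi₀i 1, ← Category.assoc, B₀.pMap_incl 1, MonObj.pow_comp, Category.id_comp]
  -- `(i₀ 2)^p ≫ π₀ = 1`, tested after `pr₁`
  have hβπ : β 2 ≫ π = 1 := by rw [← hbZ, Category.assoc, hiZπ, MonObj.comp_one]
  have lhs : (((i₀ 2) ^ p) ≫ π₀).left ≫ pullback.fst X.X.hom q = (B₀.G 2).hom ≫ q ≫ η[X.X].left :=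
    calc (((i₀ 2) ^ p) ≫ π₀).left ≫ pullback.fst X.X.hom q
        = ((i₀ 2) ^ p).left ≫ (π₀.left ≫ pullback.fst X.X.hom q) := by rw [Over.comp_left, Category.assoc]
      _ = (c 2 ≫ (β 2).left) ≫ π.left := by rw [hπ₀F, ← Category.assoc, hβ 2]
      _ = c 2 ≫ (β 2 ≫ π).left := by rw [Category.assoc, Over.comp_left]
      _ = c 2 ≫ ((B.G 2).hom ≫ η[X.X].left) := by rw [hβπ, Hom.one_def, Over.comp_left, Over.toUnit_left]
      _ = (B₀.G 2).hom ≫ q ≫ η[X.X].left := by rw [← Category.assoc, wc, Category.assoc]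
  have rhs : (1 : B₀.G 2 ⟶ (X.baseChange q).X).left ≫ pullback.fst X.X.hom q = (B₀.G 2).hom ≫ q ≫ η[X.X].left := by
    rw [Hom.one_def, Over.comp_left, Over.toUnit_left, Category.assoc, hηX]
  have h2 : ((i₀ 2) ^ p) ≫ π₀ = 1 := eq_of_left_comp_eq_of_isPullback hPX _ _ (lhs.trans rhs.symm)
  -- cancel the fppf epimorphism `[p] : B₀[p²] ↠ B₀[p]`
  haveI := B₀.flat_pMap 1
  haveI := B₀.surjective_pMap 1
  haveI : IsAffineHom (B₀.pMap 1).left := by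
    haveI := B₀.isFinite 1
    haveI := B₀.isFinite 2
    haveI : IsAffineHom ((B₀.pMap 1).left ≫ (B₀.G 1).hom) := by rw [Over.w (B₀.pMap 1)]; infer_instance
    exact IsAffineHom.of_comp (B₀.pMap 1).left (B₀.G 1).hom
  refine Over.OverMorphism.ext (hom_ext_of_fpqc (B₀.pMap 1).left ?_)
  rw [← Over.comp_left, ← Over.comp_left, ← Category.assoc, hpi, h2, MonObj.comp_one]

/-! ## §2 The kernel of the reduced quotient map on points is `X₀[p]` -/

/-- **A point killed by the reduced quotient map is `p`-torsion: `u ≫ π₀ = 1 → p·u = 1`.**  Setting as in §1, plus: `GY` a base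
change of abelian schemes along `q` (cartesian), `Z → S` finite, `b : B[p²] ↠ Z` flat and surjective with `b ≫ iZ = β 2`, and the
KERNEL CLAUSE of `π` («`u ≫ π = 1 ↔ u` factors through `iZ`» on `S`-points).  Proof: `π (GY u) = pr₁ (π₀ u) = 1`, so `GY u = iZ v`;
on the fppf cover `T′ := T ×_Z B[p²] ↠ T` (base change of `b`; flat, surjective, affine) `v = b w₂` and `w₂ = c 2 w₀` (`T′` lives
over `S′`, cartesian `c 2`), hence `GY u|T′ = β 2 (c 2 w₀) = GY ((i₀ 2)^p w₀)` (reduction clause) and `u|T′ = (i₀ 2)^p w₀` (the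
cartesian `GY` is injective on `S′`-points, ★ `eq_of_left_comp_eq_of_isPullback`); so `p · u|T′ = (i₀ 2)^{p²} w₀ = 1` (`B₀[p²]` is
killed by `p²`, ★ `BTGroup.killed`), and `p · u = 1` by fpqc descent along `T′ ↠ T` (★ `hom_ext_of_fpqc`).
[cite: Katz1981SerreTate, §1.2 proof of Thm. 1.2.1 (p. 142)] [cite: Tate1967, §2 (2.1) and (2.4)] [cite: Messing1972, Ch. I (1.1)–(1.6)] -/
theorem comp_pow_eq_one_of_comp_reduction_eq_one (X₀ : AbelianSchemeOver S') (B₀ : BTGroup S' p h)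
    (i₀ : ∀ n, B₀.G n ⟶ X₀.X) (hi₀m : ∀ n, letI := B₀.grpObj n; IsMonHom (i₀ n))
    (B : BTGroup S p h) (c : ∀ n, (B₀.G n).left ⟶ (B.G n).left) (hBc : B₀.IsBaseChangeVia B q c)
    (Y : AbelianSchemeOver S) (GY : X₀.X.left ⟶ Y.X.left) (hGY : X₀.IsBaseChangeVia Y q GY)
    (β : ∀ n, B.G n ⟶ Y.X) (hβ : ∀ n, c n ≫ (β n).left = ((i₀ n) ^ p).left ≫ GY)
    (Z : Over S) (iZ : Z ⟶ Y.X) (b : B.G 2 ⟶ Z) (hZf : IsFinite Z.hom) (hbZ : b ≫ iZ = β 2) (hbfl : Flat b.left)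
    (hbs : Surjective b.left) (X : AbelianSchemeOver S) (π : Y.X ⟶ X.X)
    (hker : ∀ (T : Over S) (u : T ⟶ Y.X), u ≫ π = 1 ↔ ∃ v : T ⟶ Z, v ≫ iZ = u)
    (π₀ : X₀.X ⟶ (X.baseChange q).X) (hπ₀F : π₀.left ≫ pullback.fst X.X.hom q = GY ≫ π.left)
    {T : Over S'} (u : T ⟶ X₀.X) (hu : u ≫ π₀ = 1) : u ≫ ((𝟙 X₀.X) ^ p) = 1 := by
  letI : ∀ n, GrpObj (B₀.G n) := B₀.grpObj
  letI : ∀ n, GrpObj (B.G n) := B.grpObj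
  haveI : ∀ n, IsMonHom (i₀ n) := hi₀m
  obtain ⟨wGY, hPGY, -, -⟩ := hGY
  obtain ⟨-, hPc, -, -⟩ := hBc.1 2
  -- the pushed point `U = GY ∘ u` of `Y` over `S` dies under `π`, hence comes from `Z`
  have wU : (u.left ≫ GY) ≫ Y.X.hom = (Over.mk (T.hom ≫ q)).hom := by
    rw [Category.assoc, wGY, ← Category.assoc, Over.w u]
    rfl
  have hUπ : (Over.homMk (u.left ≫ GY) wU : Over.mk (T.hom ≫ q) ⟶ Y.X) ≫ π = 1 :=
    (comp_reduction_eq_one_iff X₀ Y X GY π π₀ hπ₀F u rfl (Over.homMk (u.left ≫ GY) wU) rfl).mp hu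
  obtain ⟨v, hv⟩ := (hker _ _).mp hUπ
  have hvl : v.left ≫ iZ.left = u.left ≫ GY := by
    rw [← Over.comp_left, hv]
    rfl
  -- the fppf cover `T′ = T ×_Z B[p²] ↠ T` (base change of `b`), as a scheme over `S′`
  haveI := hbfl
  haveI := hbs
  haveI : IsAffineHom b.left := by
    haveI := B.isFinite 2
    haveI := hZf
    haveI : IsAffineHom (b.left ≫ Z.hom) := by rw [Over.w b]; infer_instance
    exact IsAffineHom.of_comp b.left Z.hom
  have hρ : pullback.fst v.left b.left ≫ T.hom = (Over.mk (pullback.fst v.left b.left ≫ T.hom) : Over S').hom := rfl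
  -- on `T′`, `v = b w₂` with `w₂ = c 2 w₀`, `w₀ : T′ → B₀[p²]` (cartesian `c 2`)
  have hvS : v.left ≫ Z.hom = T.hom ≫ q := Over.w v
  have hw₂ : pullback.snd v.left b.left ≫ (B.G 2).hom = (pullback.fst v.left b.left ≫ T.hom) ≫ q := by
    rw [← Over.w b, ← Category.assoc, ← pullback.condition, Category.assoc, hvS, Category.assoc]
  have hw₀S : hPc.lift _ _ hw₂ ≫ (B₀.G 2).hom = (Over.mk (pullback.fst v.left b.left ≫ T.hom) : Over S').hom :=
    hPc.lift_snd _ _ hw₂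
  have hw₀c : (Over.homMk (hPc.lift _ _ hw₂) hw₀S : Over.mk (pullback.fst v.left b.left ≫ T.hom) ⟶ B₀.G 2).left ≫ c 2 =
      pullback.snd v.left b.left := hPc.lift_fst _ _ hw₂
  -- `u|T′ = (i₀ 2)^p (w₀)`: both push forward to `β 2 (w₂)` along the cartesian `GY`
  have hu' : (Over.homMk (pullback.fst v.left b.left) hρ : Over.mk (pullback.fst v.left b.left ≫ T.hom) ⟶ T) ≫ u =
      (Over.homMk (hPc.lift _ _ hw₂) hw₀S : Over.mk (pullback.fst v.left b.left ≫ T.hom) ⟶ B₀.G 2) ≫ ((i₀ 2) ^ p) := by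
    apply eq_of_left_comp_eq_of_isPullback hPGY
    calc ((Over.homMk (pullback.fst v.left b.left) hρ : Over.mk (pullback.fst v.left b.left ≫ T.hom) ⟶ T) ≫ u).left ≫ GY
        = pullback.fst v.left b.left ≫ (u.left ≫ GY) := by
          rw [Over.comp_left, Category.assoc]
          rfl
      _ = (pullback.snd v.left b.left ≫ b.left) ≫ iZ.left := by rw [← hvl, ← Category.assoc, pullback.condition]
      _ = pullback.snd v.left b.left ≫ (β 2).left := by rw [Category.assoc, ← Over.comp_left, hbZ]
      _ = ((Over.homMk (hPc.lift _ _ hw₂) hw₀S : Over.mk (pullback.fst v.left b.left ≫ T.hom) ⟶ B₀.G 2) ≫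
            ((i₀ 2) ^ p)).left ≫ GY := by rw [Over.comp_left, Category.assoc, ← hβ 2, ← Category.assoc, hw₀c]
  -- `(i₀ 2)^(p²) = 1` (`B₀[p²]` is killed by `p²`)
  have hkill : (i₀ 2) ^ (p ^ 2) = 1 :=
    calc (i₀ 2) ^ (p ^ 2) = (𝟙 (B₀.G 2) ≫ i₀ 2) ^ (p ^ 2) := by rw [Category.id_comp]
      _ = ((𝟙 (B₀.G 2)) ^ (p ^ 2)) ≫ i₀ 2 := (MonObj.pow_comp _ _ _).symm
      _ = 1 := by rw [B₀.killed 2, MonObj.one_comp]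
  -- hence `p · u = 1` on `T′` …
  have hT' : (Over.homMk (pullback.fst v.left b.left) hρ : Over.mk (pullback.fst v.left b.left ≫ T.hom) ⟶ T) ≫
        (u ≫ ((𝟙 X₀.X) ^ p)) =
      (Over.homMk (pullback.fst v.left b.left) hρ : Over.mk (pullback.fst v.left b.left ≫ T.hom) ⟶ T) ≫ 1 := by
    rw [← Category.assoc, hu', Category.assoc, MonObj.comp_pow, Category.comp_id, ← pow_mul, ← pow_two, hkill,
      MonObj.comp_one, MonObj.comp_one]
  -- … and on `T` by fpqc descent along `T′ ↠ T`
  haveI : Flat (Over.homMk (pullback.fst v.left b.left) hρ :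
      Over.mk (pullback.fst v.left b.left ≫ T.hom) ⟶ T).left := inferInstanceAs (Flat (pullback.fst v.left b.left))
  haveI : Surjective (Over.homMk (pullback.fst v.left b.left) hρ :
      Over.mk (pullback.fst v.left b.left ≫ T.hom) ⟶ T).left :=
    inferInstanceAs (Surjective (pullback.fst v.left b.left))
  haveI : QuasiCompact (Over.homMk (pullback.fst v.left b.left) hρ :
      Over.mk (pullback.fst v.left b.left ≫ T.hom) ⟶ T).left :=
    inferInstanceAs (QuasiCompact (pullback.fst v.left b.left))
  refine Over.OverMorphism.ext (hom_ext_of_fpqc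
    (Over.homMk (pullback.fst v.left b.left) hρ : Over.mk (pullback.fst v.left b.left ≫ T.hom) ⟶ T).left ?_)
  rw [← Over.comp_left, ← Over.comp_left, hT']

/-- **THE KERNEL OF THE REDUCED QUOTIENT MAP IS THE `p`-TORSION**: `u ≫ π₀ = 1 ↔ u ≫ [p] = 1` on `T`-points of `X₀` (`T` over
`S′`), in the setting of §1–§2 with `i₀ 1 : B₀[p] → X₀` CARTESIAN against `[p]` and the unit section (the torsion-tower clause
at `n = 1`): (→) is `comp_pow_eq_one_of_comp_reduction_eq_one`; (←) a `p`-torsion point factors through `i₀ 1`, and `i₀ 1 ≫ π₀ = 1`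
(`torsionOne_comp_reduction_eq_one`, with `iZ ≫ π = 1` from the kernel clause at `u := iZ`).
[cite: Katz1981SerreTate, §1.2 proof of Thm. 1.2.1 (p. 142)] [cite: Tate1967, §2 (2.1) and (2.4)] -/
theorem comp_reduction_eq_one_iff_comp_pow_eq_one (X₀ : AbelianSchemeOver S') (B₀ : BTGroup S' p h)
    (i₀ : ∀ n, B₀.G n ⟶ X₀.X) (hi₀m : ∀ n, letI := B₀.grpObj n; IsMonHom (i₀ n))
    (hi₀P : IsPullback (i₀ 1) (toUnit (B₀.G 1)) ((𝟙 X₀.X : X₀.X ⟶ X₀.X) ^ p) η[X₀.X])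
    (hi₀i : ∀ n, B₀.incl n ≫ i₀ (n + 1) = i₀ n)
    (B : BTGroup S p h) (c : ∀ n, (B₀.G n).left ⟶ (B.G n).left) (hBc : B₀.IsBaseChangeVia B q c)
    (Y : AbelianSchemeOver S) (GY : X₀.X.left ⟶ Y.X.left) (hGY : X₀.IsBaseChangeVia Y q GY)
    (β : ∀ n, B.G n ⟶ Y.X) (hβ : ∀ n, c n ≫ (β n).left = ((i₀ n) ^ p).left ≫ GY)
    (Z : Over S) (iZ : Z ⟶ Y.X) (b : B.G 2 ⟶ Z) (hZf : IsFinite Z.hom) (hbZ : b ≫ iZ = β 2) (hbfl : Flat b.left)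
    (hbs : Surjective b.left) (X : AbelianSchemeOver S) (π : Y.X ⟶ X.X)
    (hker : ∀ (T : Over S) (u : T ⟶ Y.X), u ≫ π = 1 ↔ ∃ v : T ⟶ Z, v ≫ iZ = u)
    (π₀ : X₀.X ⟶ (X.baseChange q).X) (hπ₀F : π₀.left ≫ pullback.fst X.X.hom q = GY ≫ π.left)
    {T : Over S'} (u : T ⟶ X₀.X) : u ≫ π₀ = 1 ↔ u ≫ ((𝟙 X₀.X) ^ p) = 1 := by
  refine ⟨comp_pow_eq_one_of_comp_reduction_eq_one X₀ B₀ i₀ hi₀m B c hBc Y GY hGY β hβ Z iZ b hZf hbZ hbfl hbs X π hker π₀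
    hπ₀F u, fun hu => ?_⟩
  -- a `p`-torsion point factors through the kernel embedding `i₀ 1`
  have hw : hi₀P.lift u (toUnit T) (by rw [hu, Hom.one_def]) ≫ i₀ 1 = u := hi₀P.lift_fst _ _ _
  have hiZπ : iZ ≫ π = 1 := (hker Z iZ).mpr ⟨𝟙 Z, Category.id_comp _⟩
  rw [← hw, Category.assoc, torsionOne_comp_reduction_eq_one X₀ B₀ i₀ hi₀m hi₀i B c hBc Y GY β hβ Z iZ b hbZ X π hiZπ π₀
    hπ₀F, MonObj.comp_one]

end General

/-! ## §3 The organ E4K of the σ2 sub-sub-line `F0P6bSigma2ReductionOfQuotient`, VERBATIM -/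

/-- **ORGAN E4K «KERNEL OF THE REDUCTION» (load-bearing) of the Serre–Tate σ2 road, VERBATIM** (the sub-sub-line's
`stub_E4K_kernelOfReduction`, with its `Lines`-side predicate `IsTorsionTower X₀ B₀ i₀` ∕ `IsTorsionTower X B iX` — «`i n` are
homomorphisms, CARTESIAN against `[pⁿ]` and the unit section, `incl n ≫ i (n+1) = i n`» — spelled by its three clauses, so that the
junction's `type_of%` binder is fed BY NAME).  In E4's setting — `A` Artinian local with `(p)` nilpotent, `J` with `𝔪·J = 0`, `X₀`
an abelian scheme over `A⧸J` with `p`-divisible group `B₀` (`i₀`), `B` a Barsotti–Tate group over `A` reducing to `B₀` (`c`), `Y` an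
abelian scheme over `A` reducing to `X₀` (`GY`), lifts `β n : B[pⁿ] → Y` of `p · i₀ n`, the finite flat subgroup `Z = b(B[p²]) ⊂ Y`,
the quotient `π : Y → X = Y⧸Z` with kernel `Z`, its torsion tower `iX` — for ANY homomorphism `π₀ : X₀ → X ×_A (A⧸J)` with
`π₀ ≫ pr₁ = GY ≫ π` (the reduction of `π`), the kernel of `π₀` on `T`-points is `X₀[p]`: `u ≫ π₀ = 1 ↔ u ≫ [p] = 1`.  By
`comp_reduction_eq_one_iff_comp_pow_eq_one`; the Artinian ∕ nilpotence ∕ dimension ∕ finiteness-of-`π` binders and the tower of `X`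
are inert here (the relations `c n ≫ β n = (i₀ n)^p ≫ GY`, `b ≫ iZ = β 2`, `Ker π = Z` already encode the deformation theory).
[cite: Katz1981SerreTate, §1.2 proof of Thm. 1.2.1 (p. 142)] [cite: Tate1967, §2 (2.4)] -/
theorem kernelOfReduction :
    ∀ (p : ℕ), p.Prime → ∀ (A : Type) [CommRing A] [IsArtinianRing A] [IsLocalRing A], IsNilpotent (p : A) →
      ∀ (J : Ideal A), J ≠ ⊤ → maximalIdeal A * J = ⊥ →
      ∀ (g : ℕ) (X₀ : AbelianSchemeOver (Spec (.of (A ⧸ J)))), X₀.IsOfRelDim g →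
      ∀ (B₀ : BTGroup (Spec (.of (A ⧸ J))) p (2 * g)) (i₀ : ∀ n, B₀.G n ⟶ X₀.X),
        ((∀ n, letI := B₀.grpObj n; IsMonHom (i₀ n)) ∧
          (∀ n, IsPullback (i₀ n) (toUnit (B₀.G n)) (((𝟙 X₀.X : X₀.X ⟶ X₀.X) ^ (p ^ n) : X₀.X ⟶ X₀.X)) η[X₀.X]) ∧
          (∀ n, B₀.incl n ≫ i₀ (n + 1) = i₀ n)) →
      ∀ (B : BTGroup (Spec (.of A)) p (2 * g)) (c : ∀ n, (B₀.G n).left ⟶ (B.G n).left),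
        B₀.IsBaseChangeVia B (Spec.map (CommRingCat.ofHom (Ideal.Quotient.mk J))) c →
      ∀ (Y : AbelianSchemeOver (Spec (.of A))), Y.IsOfRelDim g → ∀ (GY : X₀.X.left ⟶ Y.X.left),
        X₀.IsBaseChangeVia Y (Spec.map (CommRingCat.ofHom (Ideal.Quotient.mk J))) GY →
      ∀ (β : ∀ n, B.G n ⟶ Y.X), (∀ n, letI := B.grpObj n; IsMonHom (β n)) → (∀ n, B.incl n ≫ β (n + 1) = β n) →
        (∀ n, c n ≫ (β n).left = ((i₀ n) ^ p).left ≫ GY) →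
      ∀ (Z : Over (Spec (.of A))) (iZ : Z ⟶ Y.X) (b : B.G 2 ⟶ Z), IsClosedImmersion iZ.left → IsFinite Z.hom → Flat Z.hom →
        b ≫ iZ = β 2 → Flat b.left → Surjective b.left →
      ∀ (X : AbelianSchemeOver (Spec (.of A))), X.IsOfRelDim g → ∀ (π : Y.X ⟶ X.X), IsMonHom π → IsFinite π.left → Flat π.left →
        Surjective π.left → (∀ (T : Over (Spec (.of A))) (u : T ⟶ Y.X), u ≫ π = 1 ↔ ∃ v : T ⟶ Z, v ≫ iZ = u) →
      ∀ (iX : ∀ n, B.G n ⟶ X.X),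
        ((∀ n, letI := B.grpObj n; IsMonHom (iX n)) ∧
          (∀ n, IsPullback (iX n) (toUnit (B.G n)) (((𝟙 X.X : X.X ⟶ X.X) ^ (p ^ n) : X.X ⟶ X.X)) η[X.X]) ∧
          (∀ n, B.incl n ≫ iX (n + 1) = iX n)) →
        (∀ n, B.pMap (n + 1) ≫ B.pMap n ≫ iX n = β (n + 2) ≫ π) →
        ∀ (π₀ : X₀.X ⟶ (X.baseChange (Spec.map (CommRingCat.ofHom (Ideal.Quotient.mk J)))).X), IsMonHom π₀ →
          π₀.left ≫ pullback.fst X.X.hom (Spec.map (CommRingCat.ofHom (Ideal.Quotient.mk J))) = GY ≫ π.left →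
          ∀ (T : Over (Spec (.of (A ⧸ J)))) (u : T ⟶ X₀.X),
            u ≫ π₀ = 1 ↔ u ≫ ((𝟙 X₀.X : X₀.X ⟶ X₀.X) ^ p) = 1 := by
  intro p _ A _ _ _ _ J _ _ g X₀ _ B₀ i₀ hT₀ B c hBc Y _ GY hGY β _ _ hβ Z iZ b _ hZf _ hbZ hbfl hbs X _ π _ _ _ _ hker _ _ _
    π₀ _ hπ₀F T u
  have hi₀P : IsPullback (i₀ 1) (toUnit (B₀.G 1)) ((𝟙 X₀.X : X₀.X ⟶ X₀.X) ^ p) η[X₀.X] := by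
    simpa only [pow_one] using hT₀.2.1 1
  exact comp_reduction_eq_one_iff_comp_pow_eq_one X₀ B₀ i₀ hT₀.1 hi₀P hT₀.2.2 B c hBc Y GY hGY β hβ Z iZ b hZf hbZ hbfl hbs
    X π hker π₀ hπ₀F u

end SerreTate

end Literature.AlgebraicGeometry.AbelianSchemes

end
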